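import Summits.BirchSwinnertonDyer.BirchSwinnertonDyer.Theorems.UniversalToricDescentRelaxedKummerPairCountStrict
import Summits.BirchSwinnertonDyer.BirchSwinnertonDyer.Theorems.SchneiderFreeAdditiveX3PoitouTateSelmerDualityHolds
import HarnessLib

/-!
# The MIXED relaxed/strict Kummer count at a layer: `#X · #(Sel/Sel_{str P}) · #(Sel/Sel_{str P′}) ≤ #Sel · ∏_{w∈P} #𝓛_w · ∏_{w∈T} #𝓛_w`
# for `X` = the `p^k`-Kummer classes RELAXED on `P ∪ T ∪ ∞`, STRICT on `P′`, Kummer elsewhere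
# (brick (B3) of the port stub `stub_residualLinkMult`, line `beta-road` v5 on crux `TwinAlgMuZeroAtThree`, stmt-BirchSwinnertonDyer-24737)

Width prover `bsd-wall-utd-p1-w2` g9 under lead `bsd-wall-utd-p1` g23 (`--supports stmt-BirchSwinnertonDyer-24737`, helper).
THEOREMS ONLY (no definition, no named fact, no `sorry`). FIELD-WORLD ONLY: everything is stated over an arbitrary number
field `K` ALL OF WHOSE INFINITE PLACES ARE COMPLEX (intended: a layer `K_n` of the anticyclotomic `ℤ₃`-tower) for an elliptic
curve `E = W/K`, a prime `p` and `k ≥ 1`; no transport, no Heegner point, no `ℤ_p`-extension appears. BSD is not proved by any of this.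

Notation (in the docstrings only): for a finset `A` of finite places, `KO(A) = H¹_{kummerRelaxed (A ∪ ∞)}(K, E[p^k])` (no condition
on `A ∪ ∞`, Kummer condition `𝓛_w = im κ_w` elsewhere) and `KS(A) = H¹_{kummerStrict (A ∪ ∞)}(K, E[p^k])` (zero on `A ∪ ∞`);
`Sel = KO(∅)`, and `KS(∅)/KS(P)` is the image of `loc_P` on the Kummer-everywhere group strict at `∞` (= `Sel`, the complex places
carrying no classes). The lead's brief (evidence #25 on the item, STUB-BRIEF-residualLinkMult-v5) asks, at every layer, for the bound
(B3) `dim S_{∅,0}(K_n) ≤ dim Sel + Σ_{w∈P} dim 𝓛_w − rk(loc_P | Sel) − rk(loc_{P′} | Sel)` for the group `S_{∅,0}` relaxed at the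
places `P` over `𝔭`, strict at the places `P′` over `𝔭′`, Kummer elsewhere; here it is proved in product form and with an extra
relaxation set `T` (the places over the finite bad set `Σ₀`, whose cost `∏_{w∈T} #𝓛_w` is bounded along the tower by Brink's finite
decomposition), from THREE applications of the lead's relaxed pair count
`UniversalToricDescentRelaxedKummerPairCount.natCard_relaxedQuotient_mul_natCard_strictQuotient_eq` (g18, p≈65xxxx;
`#(KO(A∪V)/KO(A)) · #(KS(A)/KS(A∪V)) = ∏_{w∈V} #𝓛_w`) with the Poitou–Tate fact DISCHARGED by the tree theorem
`SchneiderFreeAdditiveX3.PoitouTateReduction.poitouTate_selmerStructure_duality_holds`: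

* §1 generic subgroup bookkeeping (`natCard_eq_natCard_mul_relIndex`, membership lemmas for `kummerRelaxed`/`kummerStrict`:
  monotonicity in the exceptional set, `KS(S) ≤ KO(S′)` for all `S, S′`, and `KS(S₀) ⊓ {loc_{P′} = 0} = KS(S₀ ∪ P′)`).
* §2 `natCard_kummerRelaxed_union_le` — **`#KO(A ∪ V) ≤ #KO(A) · ∏_{w∈V} #𝓛_w`** (`A ∩ V = ∅`; the strict index is `≥ 1`).
* §3 `natCard_mixed_mul_strictIndex_le` — **`#(KO(A) ⊓ ⋂_{w∈P′} ker loc_w) · #(KS(S₀)/KS(S₀ ∪ P′)) ≤ #KO(A)`** for ANY finsets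
  `A, S₀` of places and `P′` of finite places (the `P′`-strictness of the mixed group costs at least the image of `loc_{P′}` on
  `KS(S₀) ≤ KO(A)`).
* §4 **`natCard_mixed_mul_strictIndex_mul_strictIndex_le`** — the assembled (B3):
  `#X · #(KS(∅)/KS(P)) · #(KS(∅)/KS(P′)) ≤ #KO(∅) · ∏_{w∈P} #𝓛_w · ∏_{w∈T} #𝓛_w` for `X = KO(P ∪ T) ⊓ ⋂_{w∈P′} ker loc_w`,
  `P ∩ T = ∅` (pair count at `(∅, P)` keeps the strict index at `P`; §2 at `(P, T)`; §3 at `P′`).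

On the line: `#KO(∅) ≤ 3^{3ⁿ+C}` is K2_res after the lead's layer injection (B2, `…LayerSelmerInjection`), the two strict indices are
`≥ 3^{3ⁿ−3^k+1}` resp. `≥ 3^{3ⁿ−3^{k′}+1}` by the Heegner signature bound (B4, `…ResidualNormSpanQuotient` + `…HeegnerLayerSignature`),
`∏_{w∈P} #𝓛_w = 3^{3ⁿ}` under (H0) and degree one, `#𝓛_w ≤ 9` and `#T ≤ Σ_{v∈Σ₀} 3^{c_v}` (Brink) — so `#X` is bounded uniformly in
`n`, which is what the layer control (B5, `…ResidualLayerControl`) consumes after the `Γ_K`-transport.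

References: [MilneADT2006] I Thm. 4.10, Lemma 3.3, Cor. 2.3; [Howard2004HeegnerKolyvagin] Def. 2.1.6, 2.1.10, Thm. 2.1.11;
[Castella2017HeegnerBeilinsonFlach] App. A (A.3) (the two-sided link, read modulo `p` at a finite layer);
[BertoliniDarmon1996] §2.5 (the layers).
-/

set_option linter.dupNamespace false
set_option autoImplicit false

noncomputable section
open scoped Classical
open CategoryTheory Field NumberField IsDedekindDomain Function
open Literature.NumberTheory.EllipticCurves Literature.NumberTheory.EllipticCurves.GreenbergSelmer
open Literature.NumberTheory.GaloisRepresentations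
open Literature.NumberTheory.GaloisRepresentations.DiscreteGaloisModule (SelmerStructure tateDual)
open Literature.NumberTheory.GaloisCohomology
open scoped ContRepresentation

namespace Summit.BirchSwinnertonDyer.BirchSwinnertonDyer.Theorems.UniversalToricDescentRelaxedStrictMixedCount

open Summit.BirchSwinnertonDyer.Rank1Residual.X11b.KummerPT Summit.BirchSwinnertonDyer.Rank1Residual.X11b.LocBridge
  Summit.BirchSwinnertonDyer.Rank1Residual.X11b.Levels Summit.BirchSwinnertonDyer.Rank1Residual.X11b.AcSelmer
  Summit.BirchSwinnertonDyer.Rank1Residual.X11b.Relaxation Summit.BirchSwinnertonDyer.Rank1Residual.X11b.SelmerLevelBound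
  Summit.BirchSwinnertonDyer.BirchSwinnertonDyer.Theorems.SignedEC.RelaxedKummerCount
  Summit.BirchSwinnertonDyer.BirchSwinnertonDyer.Theorems.UniversalToricDescentRelaxedKummerPairCount
  Summit.BirchSwinnertonDyer.BirchSwinnertonDyer.Theorems.SchneiderFreeAdditiveX3.PoitouTateReduction

/-! ## §1 Generic bookkeeping -/

section Generic

variable {X : Type*} [AddCommGroup X]

/-- `#(A / (B ∩ A)) = B.relIndex A` (definitional unfolding of `AddSubgroup.relIndex`/`index`). [folklore] -/
theorem natCard_quotient_addSubgroupOf_eq_relIndex (A B : AddSubgroup X) :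
    Nat.card (A ⧸ B.addSubgroupOf A) = B.relIndex A := rfl

/-- Lagrange in the form `#A = #B · [A : B]` for `B ≤ A` (no finiteness needed, `Nat.card` conventions). [folklore] -/
theorem natCard_eq_natCard_mul_relIndex {A B : AddSubgroup X} (h : B ≤ A) :
    Nat.card A = Nat.card B * B.relIndex A := by
  rw [← (B.addSubgroupOf A).card_mul_index, Nat.card_congr (AddSubgroup.addSubgroupOfEquivOfLe h).toEquiv]
  rfl

/-- `[A : Y ∩ A] = [A : A ∩ Y]` as a `Nat.card` of the quotient by `A ⊓ Y`. [folklore] -/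
theorem natCard_quotient_inf_eq_relIndex (A Y : AddSubgroup X) :
    Nat.card (A ⧸ (A ⊓ Y).addSubgroupOf A) = Y.relIndex A := by
  rw [natCard_quotient_addSubgroupOf_eq_relIndex, inf_comm, AddSubgroup.inf_relIndex_right]

end Generic

/-! ## §1b Membership bookkeeping for the relaxed / strict Kummer structures -/

section Membership

variable {K : Type} [Field K] [NumberField K] (W : WeierstrassCurve K) (n : ℕ)

/-- `KO` is monotone in the exceptional set: `S ⊆ S′ ⟹ H¹_{kummerRelaxed S} ≤ H¹_{kummerRelaxed S′}`. [folklore] -/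
theorem selmerGroup_kummerRelaxed_mono {S S' : Finset (Place K)} (h : S ⊆ S') :
    (kummerRelaxed W n S).selmerGroup ≤ (kummerRelaxed W n S').selmerGroup := by
  intro c hc
  rw [SelmerStructure.mem_selmerGroup_iff] at hc ⊢
  intro v
  by_cases hv' : v ∈ S'
  · rw [kummerRelaxed_of_mem W n S' hv']; exact AddSubgroup.mem_top _
  · have hv : v ∉ S := fun hv ↦ hv' (h hv)
    have := hc v
    rw [kummerRelaxed_of_not_mem W n S hv] at this
    rwa [kummerRelaxed_of_not_mem W n S' hv']

/-- `KS` is antitone in the exceptional set: `S ⊆ S′ ⟹ H¹_{kummerStrict S′} ≤ H¹_{kummerStrict S}`. [folklore] -/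
theorem selmerGroup_kummerStrict_anti {S S' : Finset (Place K)} (h : S ⊆ S') :
    (kummerStrict W n S').selmerGroup ≤ (kummerStrict W n S).selmerGroup := by
  intro c hc
  rw [SelmerStructure.mem_selmerGroup_iff] at hc ⊢
  intro v
  have hcv := hc v
  by_cases hv : v ∈ S
  · rw [kummerStrict_of_mem W n S' (h hv)] at hcv
    rw [kummerStrict_of_mem W n S hv]; exact hcv
  · rw [kummerStrict_of_not_mem W n S hv]
    by_cases hv' : v ∈ S'
    · rw [kummerStrict_of_mem W n S' hv', AddSubgroup.mem_bot] at hcv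
      rw [hcv]; exact zero_mem _
    · rw [kummerStrict_of_not_mem W n S' hv'] at hcv; exact hcv

/-- `KS(S) ≤ KO(S′)` for ANY two exceptional sets: a class strict on `S` and Kummer elsewhere satisfies every relaxed-or-Kummer
condition. [folklore] -/
theorem selmerGroup_kummerStrict_le_kummerRelaxed (S S' : Finset (Place K)) :
    (kummerStrict W n S).selmerGroup ≤ (kummerRelaxed W n S').selmerGroup := by
  intro c hc
  rw [SelmerStructure.mem_selmerGroup_iff] at hc ⊢
  intro v
  by_cases hv' : v ∈ S'
  · rw [kummerRelaxed_of_mem W n S' hv']; exact AddSubgroup.mem_top _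
  · rw [kummerRelaxed_of_not_mem W n S' hv']
    have hcv := hc v
    by_cases hv : v ∈ S
    · rw [kummerStrict_of_mem W n S hv, AddSubgroup.mem_bot] at hcv
      rw [hcv]; exact zero_mem _
    · rw [kummerStrict_of_not_mem W n S hv] at hcv; exact hcv

/-- **`KS(S₀) ⊓ {loc_{P′} = 0} = KS(S₀ ∪ P′)`**: a class strict on `S₀`, Kummer elsewhere, and locally trivial at the finite places of
`P′` is exactly a class strict on `S₀ ∪ P′`, Kummer elsewhere. [folklore] -/
theorem mem_selmerGroup_kummerStrict_union_iff (S₀ : Finset (Place K)) (P' : Finset (HeightOneSpectrum (𝓞 K)))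
    (c : galoisCohomology (W.torsionGaloisModule (n : ℤ)) 1) :
    c ∈ (kummerStrict W n (S₀ ∪ P'.image Sum.inr)).selmerGroup ↔
      c ∈ (kummerStrict W n S₀).selmerGroup ∧
        ∀ w ∈ P', galoisCohomology.localization (W.torsionGaloisModule (n : ℤ)) (Sum.inr w) 1 c = 0 := by
  constructor
  · intro hc
    refine ⟨selmerGroup_kummerStrict_anti W n Finset.subset_union_left hc, fun w hw ↦ ?_⟩
    rw [SelmerStructure.mem_selmerGroup_iff] at hc
    have hcw := hc (Sum.inr w)
    rwa [kummerStrict_of_mem W n _ (Finset.mem_union_right _ (Finset.mem_image_of_mem _ hw)),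
      AddSubgroup.mem_bot] at hcw
  · rintro ⟨hc, hloc⟩
    rw [SelmerStructure.mem_selmerGroup_iff] at hc ⊢
    intro v
    have hcv := hc v
    by_cases hv : v ∈ S₀ ∪ P'.image Sum.inr
    · rw [kummerStrict_of_mem W n _ hv, AddSubgroup.mem_bot]
      rcases Finset.mem_union.mp hv with hv₀ | hvP
      · rwa [kummerStrict_of_mem W n S₀ hv₀, AddSubgroup.mem_bot] at hcv
      · obtain ⟨w, hw, rfl⟩ := Finset.mem_image.mp hvP
        exact hloc w hw
    · have hv₀ : v ∉ S₀ := fun h ↦ hv (Finset.mem_union_left _ h)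
      rw [kummerStrict_of_not_mem W n _ hv]
      rwa [kummerStrict_of_not_mem W n S₀ hv₀] at hcv

/-- The subgroup form of `mem_selmerGroup_kummerStrict_union_iff`:
`KS(S₀) ⊓ ⨅_{w∈P′} ker loc_w = KS(S₀ ∪ P′)`. [folklore] -/
theorem selmerGroup_kummerStrict_inf_iInf_ker_eq (S₀ : Finset (Place K)) (P' : Finset (HeightOneSpectrum (𝓞 K))) :
    (kummerStrict W n S₀).selmerGroup ⊓
        ⨅ w ∈ P', (galoisCohomology.localization (W.torsionGaloisModule (n : ℤ)) (Sum.inr w) 1).ker =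
      (kummerStrict W n (S₀ ∪ P'.image Sum.inr)).selmerGroup := by
  ext c
  rw [mem_selmerGroup_kummerStrict_union_iff, AddSubgroup.mem_inf]
  simp only [AddSubgroup.mem_iInf, AddMonoidHom.mem_ker]

end Membership

/-! ## §2 Relaxing further costs at most the local factors -/

section Counts

variable {K : Type} [Field K] [NumberField K] (W : WeierstrassCurve K) [W.IsElliptic] (p k : ℕ)
  [Fact p.Prime]

/-- **`#KO(A ∪ V) ≤ #KO(A) · ∏_{w∈V} #𝓛_w`** for disjoint finsets `A`, `V` of finite places (all infinite places complex):
in the relaxed pair count `#(KO(A∪V)/KO(A)) · #(KS(A)/KS(A∪V)) = ∏_{w∈V} #𝓛_w` the strict index is a positive integer, and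
`#KO(A ∪ V) = #KO(A) · #(KO(A∪V)/KO(A))` (Lagrange). The Poitou–Tate input is the tree theorem
`poitouTate_selmerStructure_duality_holds K`. [cite: MilneADT2006, I Thm. 4.10 and Lemma 3.3]
[cite: Howard2004HeegnerKolyvagin, Thm. 2.1.11 (arXiv:1202.6340 p. 6)] -/
theorem natCard_kummerRelaxed_union_le (hk : 0 < k) (hK : ∀ w : InfinitePlace K, w.IsComplex)
    (A V : Finset (HeightOneSpectrum (𝓞 K))) (hAV : Disjoint A V) :
    Nat.card (kummerRelaxed W (p ^ k) ((A.image Sum.inr ∪ Finset.univ.image Sum.inl) ∪ V.image Sum.inr)).selmerGroup ≤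
      Nat.card (kummerRelaxed W (p ^ k) (A.image Sum.inr ∪ Finset.univ.image Sum.inl)).selmerGroup *
        ∏ w ∈ V, Nat.card (W.kummerSelmerStructure ((p ^ k : ℕ) : ℤ) (Sum.inr w)) := by
  have key := natCard_relaxedQuotient_mul_natCard_strictQuotient_eq W p k hk hK
    (poitouTate_selmerStructure_duality_holds K) A V hAV
  set SA : Finset (Place K) := A.image Sum.inr ∪ Finset.univ.image Sum.inl with hSA
  set SAV : Finset (Place K) := SA ∪ V.image Sum.inr with hSAV
  set prodV : ℕ := ∏ w ∈ V, Nat.card (W.kummerSelmerStructure ((p ^ k : ℕ) : ℤ) (Sum.inr w)) with hprodV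
  -- the local factors are positive
  haveI hfinloc : ∀ v : HeightOneSpectrum (𝓞 K),
      Finite (galoisCohomology ((W.torsionGaloisModule ((p ^ k : ℕ) : ℤ)).toLocal (Sum.inr v)) 1) := fun v ↦
    finite_galoisCohomology_toLocal_inr W (p ^ k) v
  have hprodVpos : 0 < prodV := Finset.prod_pos fun w _ ↦ Nat.card_pos
  -- Lagrange inside `KO(A ∪ V)`
  have hle : (kummerRelaxed W (p ^ k) SA).selmerGroup ≤ (kummerRelaxed W (p ^ k) SAV).selmerGroup :=
    selmerGroup_kummerRelaxed_mono W (p ^ k) Finset.subset_union_left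
  rw [natCard_eq_natCard_mul_relIndex hle]
  refine Nat.mul_le_mul_left _ ?_
  -- the relaxed index is at most the product (the strict index being `≥ 1`)
  rw [natCard_quotient_addSubgroupOf_eq_relIndex, natCard_quotient_addSubgroupOf_eq_relIndex] at key
  set a := ((kummerRelaxed W (p ^ k) SA).selmerGroup).relIndex (kummerRelaxed W (p ^ k) SAV).selmerGroup with ha
  set b := ((kummerStrict W (p ^ k) SAV).selmerGroup).relIndex (kummerStrict W (p ^ k) SA).selmerGroup with hb
  have hb0 : b ≠ 0 := by
    intro h0
    rw [h0, mul_zero] at key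
    exact hprodVpos.ne' key.symm
  calc a = a * 1 := (mul_one a).symm
    _ ≤ a * b := Nat.mul_le_mul_left a (Nat.one_le_iff_ne_zero.mpr hb0)
    _ = prodV := key

/-! ## §3 Imposing strictness at `P′` on a relaxed group costs at least the strict index `#(KS(S₀)/KS(S₀ ∪ P′))` -/

/-- **`#(KO(A) ⊓ ⋂_{w∈P′} ker loc_w) · #(KS(S₀)/KS(S₀ ∪ P′)) ≤ #KO(A)`** for ANY finsets `A, S₀` of places and `P′` of finite
places: `KO(A)/(KO(A) ⊓ Y)` (`Y = ⋂ ker loc_w`) has `Y.relIndex KO(A)` elements, `KS(S₀) ≤ KO(A)`, and `Y ⊓ KS(S₀) = KS(S₀ ∪ P′)`,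
so `#(KS(S₀)/KS(S₀∪P′)) = Y.relIndex KS(S₀) ≤ Y.relIndex KO(A)` (`KO(A)` is finite: Milne I Lemma 6.15, tree `finite_kummerOutside`).
[cite: MilneADT2006, I Lemma 6.15] [cite: Howard2004HeegnerKolyvagin, Def. 2.1.6, 2.1.10] -/
theorem natCard_mixed_mul_strictIndex_le (hk : 0 < k) (A S₀ : Finset (Place K))
    (P' : Finset (HeightOneSpectrum (𝓞 K))) :
    Nat.card ↥((kummerRelaxed W (p ^ k) A).selmerGroup ⊓
        ⨅ w ∈ P', (galoisCohomology.localization (W.torsionGaloisModule ((p ^ k : ℕ) : ℤ)) (Sum.inr w) 1).ker) *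
      Nat.card ((kummerStrict W (p ^ k) S₀).selmerGroup ⧸
        ((kummerStrict W (p ^ k) (S₀ ∪ P'.image Sum.inr)).selmerGroup).addSubgroupOf
          (kummerStrict W (p ^ k) S₀).selmerGroup) ≤
      Nat.card (kummerRelaxed W (p ^ k) A).selmerGroup := by
  have hprime : p.Prime := Fact.out
  haveI : NeZero (p ^ k) := ⟨pow_ne_zero k hprime.ne_zero⟩
  have _ := hk
  set ρ := W.torsionGaloisModule ((p ^ k : ℕ) : ℤ) with hρ
  set KOA := (kummerRelaxed W (p ^ k) A).selmerGroup with hKOA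
  set Y : AddSubgroup (galoisCohomology ρ 1) :=
    ⨅ w ∈ P', (galoisCohomology.localization ρ (Sum.inr w) 1).ker with hY
  set KS₀ := (kummerStrict W (p ^ k) S₀).selmerGroup with hKS₀
  -- finiteness of `KO(A)`
  haveI hfin : Finite KOA := by
    rw [hKOA, selmerGroup_kummerRelaxed]; exact finite_kummerOutside W (p ^ k) A
  -- `#KO(A) = #(KO(A) ⊓ Y) · Y.relIndex KO(A)`
  have hsplit : Nat.card KOA = Nat.card ↥(KOA ⊓ Y) * Y.relIndex KOA := by
    rw [natCard_eq_natCard_mul_relIndex (inf_le_left : KOA ⊓ Y ≤ KOA), inf_comm, AddSubgroup.inf_relIndex_right,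
      inf_comm]
  rw [hsplit]
  refine Nat.mul_le_mul_left _ ?_
  -- the strict index is `Y.relIndex KS(S₀)`
  have hstrict : Nat.card (KS₀ ⧸ ((kummerStrict W (p ^ k) (S₀ ∪ P'.image Sum.inr)).selmerGroup).addSubgroupOf KS₀) =
      Y.relIndex KS₀ := by
    rw [← selmerGroup_kummerStrict_inf_iInf_ker_eq W (p ^ k) S₀ P', natCard_quotient_inf_eq_relIndex]
  rw [hstrict]
  -- monotonicity of the relative index in the ambient group (finite ambient)
  have hle : KS₀ ≤ KOA := selmerGroup_kummerStrict_le_kummerRelaxed W (p ^ k) S₀ A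
  have hne : Y.relIndex KOA ≠ 0 := by
    rw [AddSubgroup.relIndex]
    exact AddSubgroup.index_ne_zero_of_finite
  exact AddSubgroup.relIndex_le_of_le_right hle hne

/-! ## §4 The assembled mixed count (B3) -/

/-- **The mixed relaxed/strict count (B3 of the port stub `stub_residualLinkMult`).** For disjoint finsets `P`, `T` of finite places,
any finset `P′` of finite places, all infinite places of `K` complex and `k ≥ 1`, with
`X = KO(P ∪ T) ⊓ ⋂_{w∈P′} ker loc_w` (no condition on `P ∪ T ∪ ∞`, locally trivial on `P′`, Kummer elsewhere):
`#X · #(KS(∅)/KS(P)) · #(KS(∅)/KS(P′)) ≤ #KO(∅) · ∏_{w∈P} #𝓛_w · ∏_{w∈T} #𝓛_w`.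
Proof: the relaxed pair count at `(∅, P)` gives `#KO(P) · #(KS(∅)/KS(P)) = #KO(∅) · ∏_{P} #𝓛_w`; §2 at `(P, T)` gives
`#KO(P ∪ T) ≤ #KO(P) · ∏_{T} #𝓛_w`; §3 gives `#X · #(KS(∅)/KS(P′)) ≤ #KO(P ∪ T)`.
[cite: Castella2017HeegnerBeilinsonFlach, App. A (A.3) (arXiv:1509.02761 p. 19)] [cite: MilneADT2006, I Thm. 4.10, Lemma 3.3, Lemma 6.15]
[cite: Howard2004HeegnerKolyvagin, Thm. 2.1.11 (arXiv:1202.6340 p. 6)] -/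
theorem natCard_mixed_mul_strictIndex_mul_strictIndex_le (hk : 0 < k) (hK : ∀ w : InfinitePlace K, w.IsComplex)
    (P T P' : Finset (HeightOneSpectrum (𝓞 K))) (hPT : Disjoint P T) :
    Nat.card ↥((kummerRelaxed W (p ^ k) ((P.image Sum.inr ∪ Finset.univ.image Sum.inl) ∪ T.image Sum.inr)).selmerGroup ⊓
        ⨅ w ∈ P', (galoisCohomology.localization (W.torsionGaloisModule ((p ^ k : ℕ) : ℤ)) (Sum.inr w) 1).ker) *
      Nat.card ((kummerStrict W (p ^ k) (Finset.univ.image Sum.inl)).selmerGroup ⧸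
        ((kummerStrict W (p ^ k) (Finset.univ.image Sum.inl ∪ P.image Sum.inr)).selmerGroup).addSubgroupOf
          (kummerStrict W (p ^ k) (Finset.univ.image Sum.inl)).selmerGroup) *
      Nat.card ((kummerStrict W (p ^ k) (Finset.univ.image Sum.inl)).selmerGroup ⧸
        ((kummerStrict W (p ^ k) (Finset.univ.image Sum.inl ∪ P'.image Sum.inr)).selmerGroup).addSubgroupOf
          (kummerStrict W (p ^ k) (Finset.univ.image Sum.inl)).selmerGroup) ≤
      Nat.card (kummerRelaxed W (p ^ k) (Finset.univ.image Sum.inl)).selmerGroup *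
        (∏ w ∈ P, Nat.card (W.kummerSelmerStructure ((p ^ k : ℕ) : ℤ) (Sum.inr w))) *
        ∏ w ∈ T, Nat.card (W.kummerSelmerStructure ((p ^ k : ℕ) : ℤ) (Sum.inr w)) := by
  set R : Finset (Place K) := Finset.univ.image Sum.inl with hR
  set SP : Finset (Place K) := P.image Sum.inr ∪ R with hSP
  set SPT : Finset (Place K) := SP ∪ T.image Sum.inr with hSPT
  set prodP : ℕ := ∏ w ∈ P, Nat.card (W.kummerSelmerStructure ((p ^ k : ℕ) : ℤ) (Sum.inr w)) with hprodP
  set prodT : ℕ := ∏ w ∈ T, Nat.card (W.kummerSelmerStructure ((p ^ k : ℕ) : ℤ) (Sum.inr w)) with hprodT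
  set x := Nat.card ↥((kummerRelaxed W (p ^ k) SPT).selmerGroup ⊓
    ⨅ w ∈ P', (galoisCohomology.localization (W.torsionGaloisModule ((p ^ k : ℕ) : ℤ)) (Sum.inr w) 1).ker) with hx
  set sP := Nat.card ((kummerStrict W (p ^ k) R).selmerGroup ⧸
    ((kummerStrict W (p ^ k) (R ∪ P.image Sum.inr)).selmerGroup).addSubgroupOf
      (kummerStrict W (p ^ k) R).selmerGroup) with hsP
  set sP' := Nat.card ((kummerStrict W (p ^ k) R).selmerGroup ⧸
    ((kummerStrict W (p ^ k) (R ∪ P'.image Sum.inr)).selmerGroup).addSubgroupOf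
      (kummerStrict W (p ^ k) R).selmerGroup) with hsP'
  -- (1) strictness at `P′`: `x · sP′ ≤ #KO(P ∪ T)`
  have h1 : x * sP' ≤ Nat.card (kummerRelaxed W (p ^ k) SPT).selmerGroup :=
    natCard_mixed_mul_strictIndex_le W p k hk SPT R P'
  -- (2) relaxing at `T`: `#KO(P ∪ T) ≤ #KO(P) · prodT`
  have h2 : Nat.card (kummerRelaxed W (p ^ k) SPT).selmerGroup ≤
      Nat.card (kummerRelaxed W (p ^ k) SP).selmerGroup * prodT :=
    natCard_kummerRelaxed_union_le W p k hk hK P T hPT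
  -- (3) the pair count at `(∅, P)`: `#KO(P) · sP = #KO(∅) · prodP`
  have h3 : Nat.card (kummerRelaxed W (p ^ k) SP).selmerGroup * sP =
      Nat.card (kummerRelaxed W (p ^ k) R).selmerGroup * prodP := by
    have key := natCard_relaxedQuotient_mul_natCard_strictQuotient_eq W p k hk hK
      (poitouTate_selmerStructure_duality_holds K) ∅ P (Finset.disjoint_empty_left P)
    rw [Finset.image_empty, Finset.empty_union] at key
    -- fold the strict index first, then identify `R ∪ P = SP` in the relaxed index only
    rw [← hsP] at key
    have hRP : R ∪ P.image Sum.inr = SP := by rw [hSP, Finset.union_comm]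
    rw [hRP, natCard_quotient_addSubgroupOf_eq_relIndex] at key
    have hle : (kummerRelaxed W (p ^ k) R).selmerGroup ≤ (kummerRelaxed W (p ^ k) SP).selmerGroup :=
      selmerGroup_kummerRelaxed_mono W (p ^ k) (by rw [hSP]; exact Finset.subset_union_right)
    rw [natCard_eq_natCard_mul_relIndex hle, mul_assoc, key]
  -- assemble
  calc x * sP * sP' = x * sP' * sP := by ring
    _ ≤ Nat.card (kummerRelaxed W (p ^ k) SPT).selmerGroup * sP := Nat.mul_le_mul_right _ h1
    _ ≤ Nat.card (kummerRelaxed W (p ^ k) SP).selmerGroup * prodT * sP := Nat.mul_le_mul_right _ h2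
    _ = Nat.card (kummerRelaxed W (p ^ k) SP).selmerGroup * sP * prodT := by ring
    _ = Nat.card (kummerRelaxed W (p ^ k) R).selmerGroup * prodP * prodT := by rw [h3]

end Counts

end Summit.BirchSwinnertonDyer.BirchSwinnertonDyer.Theorems.UniversalToricDescentRelaxedStrictMixedCount

end
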